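import Literature.Probability.Percolation.BondInterfaceFaceDomainULC
import Literature.Probability.LatticeModels.MeshDomainJordan
import HarnessLib

/-!
# Winding number constant on a path-connected set of inner cells (stub of line `face-kernel-k1`)

For a closed piece `bloop i m hm hcl` of the left-hand boundary walk `E.bwalk d₀` of the union of
inner faces of a discrete Dobrushin datum `E`, and a path-connected set `S ⊆ ℂ` all of whose
closed mesh cells are inner faces, the winding number of the lattice face containing the
descaled point `δ⁻¹ z` is the same for all `z ∈ S`.

Proof: a point of the scaled polygon lies on the scaled segment of an out-dart
`p = E.bwalk d₀ (i + t % m)`, which is a side of the closed cell of the right-hand face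
`faceAt p.1 (p.2 + 3)`; that face is not inner, so the point is not in `S`. Hence `S` misses the
scaled polygon, any two points of `S` are joined off it, and after descaling by `δ⁻¹` the
winding number `W ∘ flFace` is constant along the path (`ClosedWalk.W_flFace_eq_of_joinedIn`).
-/

noncomputable section

open scoped Topology
open Filter Set Metric
open Literature.Probability Literature.Probability.LatticeModels Literature.Probability.Percolation
open Literature.Probability.LatticeModels.DiscreteDobrushin Literature.Probability.LatticeModels.Mesh
open Literature.Probability.RandomPlanarGeometry

namespace Summit.CriticalPhenomena.CardyFormulaZ2.Cruxes.ParafermionToSLESixFamilies.FaceKernel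

/-- **Winding number constant on a path-connected set of inner cells.** For a closed piece
`bloop i m hm hcl` of the boundary walk `E.bwalk d₀` (started at a face-boundary dart `d₀`) and a
path-connected set `S` all of whose closed mesh cells are inner faces of `E`, the winding number
of the lattice face containing `δ⁻¹ z` does not depend on `z ∈ S`. -/
theorem stub_W_eq_of_isPathConnected :
    ∀ (E : DiscreteDobrushin), 0 < E.δ → ∀ (d₀ : Site 2 × Fin 4), E.IsOutEdge d₀.1 d₀.2 →
      ∀ (i m : ℕ) (hm : 0 < m) (hcl : (E.bwalk d₀ (i + m)).1 = (E.bwalk d₀ i).1) (S : Set ℂ),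
        IsPathConnected S →
        (∀ (F : Site 2) (z : ℂ), z ∈ S → z ∈ closure (cell E.δ (F 0) (F 1)) → E.IsInnerFace F) →
        ∀ z ∈ S, ∀ w ∈ S,
          (bloop i m hm hcl).W (flFace ((E.δ : ℂ)⁻¹ * z)) =
            (bloop i m hm hcl).W (flFace ((E.δ : ℂ)⁻¹ * w)) := by
  intro E hδ d₀ h₀ i m hm hcl S hS hinner z hz w hw
  have hδ0 : (E.δ : ℂ) ≠ 0 := by exact_mod_cast hδ.ne'
  -- (1) `S` misses the scaled polygon: a point of the polygon lies on a side of the closed cell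
  -- of the right-hand face of an out-dart, which is not inner
  have hSsub : S ⊆ ((bloop i m hm hcl).strace E.δ)ᶜ := by
    intro x hxS hx
    obtain ⟨t, -, ht⟩ := (bloop i m hm hcl).mem_strace_iff.1 hx
    rw [bloop_v, bloop_v_succ, ← meshPoint_eq_mul_latC, ← meshPoint_eq_mul_latC] at ht
    set p := E.bwalk d₀ (i + t % m)
    have hout := isOutEdge_bwalk h₀ (i + t % m)
    have hxG : x ∈ closure (cell E.δ (faceAt p.1 (p.2 + 3) 0) (faceAt p.1 (p.2 + 3) 1)) :=
      segment_subset_closure_cell_of_isCorner hδ (isCorner_faceAt p.1 (p.2 + 3))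
        ((isCorner_add_faceAt_iff p.1 p.2 (p.2 + 3)).2 (Or.inr rfl)) ht
    exact hout.2 (hinner _ x hxS hxG)
  -- (2) join `z` to `w` inside `S`, hence off the scaled polygon
  have hj : JoinedIn ((bloop i m hm hcl).strace E.δ)ᶜ z w := (hS.joinedIn z hz w hw).mono hSsub
  -- (3) descale by `δ⁻¹`
  have hj' : JoinedIn (bloop i m hm hcl).traceᶜ ((E.δ : ℂ)⁻¹ * z) ((E.δ : ℂ)⁻¹ * w) := by
    have h := hj.map (f := fun z : ℂ => (E.δ : ℂ)⁻¹ * z) (continuous_const.mul continuous_id)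
    refine h.mono ?_
    rintro _ ⟨u, hu, rfl⟩ hut
    refine hu ⟨(E.δ : ℂ)⁻¹ * u, hut, ?_⟩
    simp only [← mul_assoc, mul_inv_cancel₀ hδ0, one_mul]
  -- (4) the winding number is constant along paths off the trace
  exact (bloop i m hm hcl).W_flFace_eq_of_joinedIn hm hj'

end Summit.CriticalPhenomena.CardyFormulaZ2.Cruxes.ParafermionToSLESixFamilies.FaceKernel

end
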